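import Summits.BirchSwinnertonDyer.Rank1Residual.GaloisImage.PrimeChoiceLocal
import Summits.BirchSwinnertonDyer.Rank1Residual.GaloisImage.KolyvaginPrimeTransverse
import Literature.NumberTheory.GaloisRepresentations.InducedGaloisRep

/-!
# The local criterion for transversality: a global cocycle which is a coboundary at an arithmetic
# Frobenius fixing `K_v(μ_ℓ)` and on the inertia inside `Gal(K̄_v/K_v(μ_ℓ))` localises into the
# `K_v(μ_ℓ)`-transverse subgroup — file 4a of row T-DER-TR (cell `b2b-bsdres`, team n1011, seat
# p15 GEN 8, OWNERS row T-DER-TR = skel/T-DER-TR.md)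

HONEST FRAMING (cell `b2b-bsdres`, run/shared/lean/b2b/bsd-rank1-residual/, verbatim in every
file): the goal of the cell is to DELETE the COMBINATION-SHAPED residual classes of the
Birch–Swinnerton-Dyer formula for ALL analytic-rank `≤ 1` elliptic curves over `ℚ` — "full BSD
formula for every rank `≤ 1` curve in class `C`" assembled STRICTLY from published theorems — so
that the rank-`≤ 1` remainder becomes exactly the CONSTRUCTION-SHAPED classes, which are TYPED
(missing-input `Prop`s), NOT attempted. This is not "finishing BSD". Team n1011: research route on
the CONSTRUCTION-SHAPED class X4 / §I N11 (route-1 PORT, (P-DER)); TOOL theorems of continuous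
group cohomology (no definition, no named fact, no `sorry`); curve-free, `p`-free.

## What ([MR04] Lemma 1.2.4 / Rubin PCMI Prop. 1.4.13 in the transverse direction)

* `contOneCocycles.apply_eq_zero_of_mem` — LOCAL (`L` a nonarchimedean local field, `π` a discrete
  `Γ_L`-module unramified: `π(I_L) = 1`): a continuous crossed homomorphism `ψ : Γ_L → M` which
  vanishes at an arithmetic Frobenius `φ₀` lying in an OPEN NORMAL subgroup `H ≤ Γ_L` and on
  `I_L ∩ H` vanishes on ALL of `H` — Frobenius generates `Γ_L` modulo every open normal subgroup
  containing `I_L` (tree `exists_pow_eq_mk`), and `φ₀ ∈ H`, `H ⊴ Γ_L` bring the inertia factor back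
  into `H` (PrimeChoice `contOneCocycles_eq_zero_of_absInertia_of_frob` is the case `H = Γ_L`);
* `contOneCocycles.apply_eq_rho_sub_of_mem` — the same for "`ψ` is the coboundary of `x`" instead
  of "`ψ = 0`";
* `localization_mem_transverseSubgroup_of_apply_frob` — GLOBAL ⇒ LOCAL (`K` a number field, `v` a
  finite place, `ℓ` a prime invertible in `K_v`): if a global cocycle `Φ`
  satisfies `Φ(res φ₁) = res φ₁ · x − x` for a local Frobenius `φ₁ ∈ Γ_{K_v}` FIXING `μ_ℓ`
  (`χ̄_ℓ(φ₁) = 1`) and `Φ(res τ) = res τ · x − x` for every `τ ∈ I_{K_v}` fixing `μ_ℓ`, then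
  `loc_v [Φ]` lies in the `K_v(μ_ℓ)`-TRANSVERSE subgroup `ker (H¹(K_v, M) → H¹(K_v(μ_ℓ), M))`
  (`mem_transverseSubgroup_cyclotomicField_iff`: the classes principal on `ker χ̄_ℓ`).  For `K = ℚ`,
  `ℓ = q` this is `loc_q [Φ] ∈ cyclotomicTransverse ρ (Sum.inr q)`; the inputs are the output of
  file 3b `exists_apply_eq_rho_sub_of_deriv` for the derivative class `κ_n` (THEOREM D-tr).
No number theory beyond the tree's local structure (`exists_pow_eq_mk`, `absInertia`).

References: B. Mazur, K. Rubin, *Kolyvagin systems*, Mem. AMS 799 (2004), Def. 1.1.6 (iv),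
Lemma 1.2.4; K. Rubin, *Euler systems and Kolyvagin systems* (PCMI 18, 2011), Def. 1.9.4,
Prop. 1.4.13; J.-P. Serre, *Local Fields*, XIII §1.
-/

noncomputable section

open Function Field NumberField IsDedekindDomain ValuativeRel
open Literature.NumberTheory.GaloisRepresentations
open Literature.NumberTheory.GaloisRepresentations.IsNonarchimedeanLocalField
open scoped NumberField Pointwise

universe u

namespace Summit.BirchSwinnertonDyer.Rank1Residual.GaloisImage

namespace Derivative

namespace Transverse

/-! ### §1 Local: vanishing on an open normal subgroup containing a Frobenius -/

section Local

variable {L : Type u} [Field L] [ValuativeRel L] [TopologicalSpace L] [IsNonarchimedeanLocalField L]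
variable {M : Type u} [AddCommGroup M] [TopologicalSpace M] [DiscreteTopology M]

/-- **A continuous crossed homomorphism of `Γ_L` vanishing at an arithmetic Frobenius `φ₀ ∈ H` and
on `I_L ∩ H`, for an OPEN NORMAL subgroup `H`, vanishes on `H`.**
Proof: `ψ` is right-invariant under an open normal `W`; `U := (W ⊓ H) ⊔ I_L` is open normal
containing `I_L`, so every `t` is `φ₀ⁱ u` with `u ∈ U = (W ⊓ H) · I_L` (`exists_pow_eq_mk`); for
`t ∈ H` the inertia factor of `u` lies in `H` (as `φ₀ ∈ H`), so `ψ(u) = 0` and `ψ(t) = 0`.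
[cite: Rubin2011, Prop. 1.4.13 (1) (p. 9)] [cite: SerreLocalFields1979, XIII §1 Prop. 1] -/
theorem contOneCocycles.apply_eq_zero_of_mem (π : DiscreteGaloisModule L M)
    (H : Subgroup (absoluteGaloisGroup L)) [H.Normal]
    (hH : IsOpen (H : Set (absoluteGaloisGroup L)))
    (ψ : contOneCocycles π.toTopRep) (hI : ∀ t ∈ absInertia L, t ∈ H → ψ.1 t = 0)
    {φ₀ : absoluteGaloisGroup L} (hφ₀ : IsFrobPow φ₀ 1) (hφ₀H : φ₀ ∈ H) (h0 : ψ.1 φ₀ = 0) :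
    ∀ t ∈ H, ψ.1 t = 0 := by
  haveI := absoluteGaloisGroup_compactSpace L
  -- right-invariance under an open normal subgroup `W`
  obtain ⟨V, hV, hVψ⟩ := exists_nhds_one_forall_eq' (X := absoluteGaloisGroup L)
    (P := absoluteGaloisGroup L) (fun a b => ψ.1 (a * b)) (ψ.1.continuous.comp continuous_mul)
  have h1 : (1 : absoluteGaloisGroup L) ∈ interior V := mem_interior_iff_mem_nhds.2 hV
  obtain ⟨W, hW⟩ := ProfiniteGrp.exist_openNormalSubgroup_sub_open_nhds_of_one isOpen_interior h1
  have hWψ : ∀ a : absoluteGaloisGroup L, ∀ w ∈ (W : Subgroup (absoluteGaloisGroup L)),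
      ψ.1 (a * w) = ψ.1 a := by
    intro a w hw
    have h := hVψ a w (interior_subset (hW hw))
    rwa [mul_one] at h
  -- the open normal subgroup `U = (W ⊓ H) · I_L ⊇ I_L`
  haveI := absInertia_normal_holds L
  haveI : ((W : Subgroup (absoluteGaloisGroup L)) ⊓ H).Normal := inferInstance
  set U : Subgroup (absoluteGaloisGroup L) :=
    ((W : Subgroup (absoluteGaloisGroup L)) ⊓ H) ⊔ absInertia L with hU_def
  have hWHo : IsOpen (((W : Subgroup (absoluteGaloisGroup L)) ⊓ H : Subgroup _) :
      Set (absoluteGaloisGroup L)) := by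
    rw [Subgroup.coe_inf]
    exact W.isOpen'.inter hH
  have hUo : IsOpen (U : Set (absoluteGaloisGroup L)) :=
    Subgroup.isOpen_mono (le_sup_left : ((W : Subgroup (absoluteGaloisGroup L)) ⊓ H) ≤ U) hWHo
  have hIU : absInertia L ≤ U := le_sup_right
  -- powers of the Frobenius
  have hpow : ∀ i : ℕ, ψ.1 (φ₀ ^ i) = 0 := fun i => by
    induction i with
    | zero => rw [pow_zero]; exact contOneCocycles.apply_one ψ
    | succ i ih => rw [pow_succ, ψ.2, ih, h0, map_zero, zero_add]
  intro t ht
  obtain ⟨i, hi⟩ := exists_pow_eq_mk L hUo hIU hφ₀ (QuotientGroup.mk t)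
  rw [← QuotientGroup.mk_pow, QuotientGroup.eq] at hi
  -- `u := t⁻¹ φ₀ⁱ ∈ U ∩ H`; write `u = w τ` with `w ∈ W ⊓ H`, `τ ∈ I_L`, then `τ ∈ H`
  have huH : t⁻¹ * φ₀ ^ i ∈ H := H.mul_mem (H.inv_mem ht) (H.pow_mem hφ₀H i)
  have hu' : t⁻¹ * φ₀ ^ i ∈ ((((W : Subgroup (absoluteGaloisGroup L)) ⊓ H : Subgroup _) :
      Set (absoluteGaloisGroup L)) * (absInertia L : Set (absoluteGaloisGroup L))) := by
    rw [← Subgroup.normal_mul]; exact hi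
  obtain ⟨w, hw, τ, hτ, hwτ⟩ := Set.mem_mul.1 hu'
  have hwH : w ∈ H := (Subgroup.mem_inf.mp hw).2
  have hwW : w ∈ (W : Subgroup (absoluteGaloisGroup L)) := (Subgroup.mem_inf.mp hw).1
  have hτH : τ ∈ H := by
    have : τ = w⁻¹ * (t⁻¹ * φ₀ ^ i) := by rw [← hwτ, inv_mul_cancel_left]
    rw [this]
    exact H.mul_mem (H.inv_mem hwH) huH
  have hψu : ψ.1 (t⁻¹ * φ₀ ^ i) = 0 := by
    rw [← hwτ, ψ.2 w τ, hI τ hτ hτH, map_zero, add_zero]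
    have h := hWψ 1 w hwW
    rwa [one_mul, contOneCocycles.apply_one] at h
  -- `ψ(u⁻¹) = −u⁻¹ ψ(u) = 0` and `t = φ₀ⁱ u⁻¹`
  have hψuinv : ψ.1 (t⁻¹ * φ₀ ^ i)⁻¹ = 0 := by
    have h : ψ.1 ((t⁻¹ * φ₀ ^ i)⁻¹ * (t⁻¹ * φ₀ ^ i)) =
        ψ.1 (t⁻¹ * φ₀ ^ i)⁻¹ + π.toTopRep.ρ (t⁻¹ * φ₀ ^ i)⁻¹ (ψ.1 (t⁻¹ * φ₀ ^ i)) := ψ.2 _ _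
    rw [inv_mul_cancel, contOneCocycles.apply_one, hψu, map_zero, add_zero] at h
    exact h.symm
  have hteq : t = φ₀ ^ i * (t⁻¹ * φ₀ ^ i)⁻¹ := by group
  rw [hteq, ψ.2, hpow, hψuinv, map_zero, zero_add]

/-- The same for coboundary values: if `ψ(φ₀) = φ₀ x − x` and `ψ(τ) = τ x − x` on `I_L ∩ H`
(`φ₀ ∈ H` a Frobenius, `H` open normal), then `ψ(t) = t x − x` for all
`t ∈ H`. [folklore] -/
theorem contOneCocycles.apply_eq_rho_sub_of_mem (π : DiscreteGaloisModule L M)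
    (H : Subgroup (absoluteGaloisGroup L)) [H.Normal]
    (hH : IsOpen (H : Set (absoluteGaloisGroup L)))
    (ψ : contOneCocycles π.toTopRep) (x : M)
    (hI : ∀ t ∈ absInertia L, t ∈ H → ψ.1 t = π t x - x)
    {φ₀ : absoluteGaloisGroup L} (hφ₀ : IsFrobPow φ₀ 1) (hφ₀H : φ₀ ∈ H) (h0 : ψ.1 φ₀ = π φ₀ x - x) :
    ∀ t ∈ H, ψ.1 t = π t x - x := by
  set w : contOneCocycles π.toTopRep := ψ - coboundaryCocycle π x with hwdef
  have hwapp : ∀ g, w.1 g = ψ.1 g - (π g x - x) := fun g => by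
    rw [hwdef, Submodule.coe_sub, ContinuousMap.sub_apply, coboundaryCocycle_apply]
  have hw := contOneCocycles.apply_eq_zero_of_mem π H hH w
    (fun t ht htH => by rw [hwapp, hI t ht htH, sub_self]) hφ₀ hφ₀H (by rw [hwapp, h0, sub_self])
  intro t ht
  have h := hw t ht
  rwa [hwapp, sub_eq_zero] at h

end Local

/-! ### §2 Global ⇒ local: membership in the cyclotomic transverse subgroup -/

section Global

variable {K : Type u} [Field K] [NumberField K] {M : Type u} [AddCommGroup M] [TopologicalSpace M]
  [DiscreteTopology M] (ρ : DiscreteGaloisModule K M)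

/-- The kernel of the mod-`ℓ` cyclotomic character of a field `F` is an open normal subgroup of
`Γ_F` (it is the image of `Γ_{F(μ_ℓ)}`). [folklore] -/
theorem isOpen_ker_modPCyclotomicCharacterZMod (F : Type u) [Field F] [CharZero F] (ℓ : ℕ)
    [Fact ℓ.Prime] [NeZero (ℓ : F)] :
    IsOpen ((modPCyclotomicCharacterZMod F ℓ).ker : Set (absoluteGaloisGroup F)) := by
  haveI : FiniteDimensional F (CyclotomicField ℓ F) :=
    IsCyclotomicExtension.finiteDimensional {ℓ} F (CyclotomicField ℓ F)
  have h : ((modPCyclotomicCharacterZMod F ℓ).ker : Set (absoluteGaloisGroup F)) =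
      Set.range (absGaloisRestrict F (CyclotomicField ℓ F)) := by
    ext g
    rw [SetLike.mem_coe, MonoidHom.mem_ker, Set.mem_range]
    exact (Literature.NumberTheory.Automorphic.mem_range_absGaloisRestrict_cyclotomic_iff ℓ
      (CyclotomicField ℓ F) g).symm.trans
      MonoidHom.mem_range
  rw [h]
  exact isOpen_range_absGaloisRestrict F (CyclotomicField ℓ F)

/-- **GLOBAL ⇒ LOCAL (the transverse clause).**  Let `v` be a finite place of `K`, `ℓ` a prime
invertible in `K_v`, `Φ : Γ_K → M` a continuous crossed homomorphism and
`x ∈ M` such that, along `res = absGaloisRestrict K K_v`, `Φ(res φ₁) = res φ₁ · x − x` for ONE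
local arithmetic Frobenius `φ₁` FIXING `μ_ℓ` (`χ̄_ℓ(φ₁) = 1`) and `Φ(res τ) = res τ · x − x` for every
`τ ∈ I_{K_v}` fixing `μ_ℓ`.  Then `loc_v [Φ]` lies in the `K_v(μ_ℓ)`-transverse subgroup
`ker (H¹(K_v, M) → H¹(K_v(μ_ℓ), M))` (the classes principal on `ker χ̄_ℓ = Γ_{K_v(μ_ℓ)}`,
`mem_transverseSubgroup_cyclotomicField_iff`).  For `K = ℚ`, `ℓ = q` this is the transverse
condition `cyclotomicTransverse ρ (Sum.inr q)` of the canonical Kolyvagin datum.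
[cite: MazurRubin2004, Def. 1.1.6 (iv) and Lemma 1.2.4 (pp. 9–11)]
[cite: Rubin2011, Def. 1.9.4 (p. 14)] -/
theorem localization_mem_transverseSubgroup_of_apply_frob (v : HeightOneSpectrum (𝓞 K))
    (ℓ : ℕ) [Fact ℓ.Prime] [NeZero (ℓ : v.adicCompletion K)]
    (Φ : contOneCocycles ρ.toTopRep) (x : M) {φ₁ : absoluteGaloisGroup (v.adicCompletion K)}
    (hφ₁ : IsFrobPow φ₁ 1) (hφ₁ℓ : modPCyclotomicCharacterZMod (v.adicCompletion K) ℓ φ₁ = 1)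
    (hΦφ : Φ.1 (absGaloisRestrict K (v.adicCompletion K) φ₁) =
      ρ (absGaloisRestrict K (v.adicCompletion K) φ₁) x - x)
    (hΦI : ∀ τ ∈ absInertia (v.adicCompletion K), modPCyclotomicCharacterZMod (v.adicCompletion K) ℓ τ = 1 →
      Φ.1 (absGaloisRestrict K (v.adicCompletion K) τ) = ρ (absGaloisRestrict K (v.adicCompletion K) τ) x - x) :
    galoisCohomology.localization ρ (Sum.inr v) 1 (oneCocycleClass ρ.toTopRep Φ) ∈
      DiscreteGaloisModule.transverseSubgroup (GaloisRep.toLocal v ρ) (CyclotomicField ℓ (v.adicCompletion K)) := by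
  set L := v.adicCompletion K with hL
  set res := absGaloisRestrict K L with hres_def
  haveI : CharZero L := charZero_of_injective_algebraMap (algebraMap K L).injective
  -- the local class is `[Φ ∘ res]`
  rw [PrimeChoice.localization_inr_oneCocycleClass]
  change oneCocycleClass (DiscreteGaloisModule.toTopRep (GaloisRep.restrictField L ρ)) _ ∈
    DiscreteGaloisModule.transverseSubgroup (GaloisRep.restrictField L ρ) (CyclotomicField ℓ L)
  rw [mem_transverseSubgroup_cyclotomicField_iff]
  refine ⟨x, ?_⟩
  -- the local cocycle `ψ = Φ ∘ res` is the coboundary of `x` on `ker χ̄_ℓ`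
  set ψ : contOneCocycles (DiscreteGaloisModule.toTopRep (GaloisRep.restrictField L ρ)) :=
    contOneCocycles.pullback res (X := ρ.toTopRep)
      (Y := DiscreteGaloisModule.toTopRep (GaloisRep.restrictField L ρ))
      (TopRep.ofHom ⟨ContinuousLinearMap.id ℤ M, fun _ => rfl⟩) Φ with hψ_def
  have hψapply : ∀ g, ψ.1 g = Φ.1 (res g) := fun g => rfl
  haveI : (modPCyclotomicCharacterZMod L ℓ).ker.Normal := inferInstance
  have hφ₁H : φ₁ ∈ (modPCyclotomicCharacterZMod L ℓ).ker := by
    rw [MonoidHom.mem_ker]; exact hφ₁ℓ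
  have key := contOneCocycles.apply_eq_rho_sub_of_mem (GaloisRep.restrictField L ρ)
    (modPCyclotomicCharacterZMod L ℓ).ker (isOpen_ker_modPCyclotomicCharacterZMod L ℓ) ψ x
    (fun t ht htH => by
      rw [hψapply, hΦI t ht (by rwa [MonoidHom.mem_ker] at htH)]
      rfl)
    hφ₁ hφ₁H (by rw [hψapply, hΦφ]; rfl)
  intro g hg
  have h := key g (by rw [MonoidHom.mem_ker]; exact hg)
  rw [hψapply] at h
  exact h

end Global

end Transverse

end Derivative

end Summit.BirchSwinnertonDyer.Rank1Residual.GaloisImage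

end
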